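import Summits.HubbardSuperconductivity.HubbardSuperconductivity.Theses.ColourTheSpin
import Literature.MathematicalPhysics.QuantumLattice.FermionHopAmplitudeBound
import Literature.MathematicalPhysics.QuantumLattice.FinDimSpectrumProofs
import Literature.MathematicalPhysics.QuantumLattice.HubbardAtomicLimit
import Literature.MathematicalPhysics.QuantumLattice.WilsonHoppingAlgebra
import Summits.HubbardSuperconductivity.HubbardSuperconductivity.Theorems.DeformationLadderLowEnergyRigiditySpinSqueezeKinematic

/-!
# `SgCorridor` — negative side, part 1/3: link averaging (electric freezing of `SgAnchorOrder`)

Crux `SgCorridor := SgAnchorOrder → SgCorridorOrder` (stmt-HubbardSuperconductivity-16274, route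
`ColourTheSpin`) is VACUOUS: its hypothesis `SgAnchorOrder` (stmt-16273) is false, see
`Theorems/ColourTheSpinSgAnchorOrderRefutation.lean` for the statement, the argument and the repair.
This file holds the model-free linear algebra of the refutation:

* Euclidean-norm bookkeeping for coordinate vectors (`eucNorm`), fibrewise action and norm of
  Kronecker-with-diagonal ("fibred") operators `A ⊗ diag d`;
* contraction bounds for the Jordan–Wigner matrices (`‖c†_p w‖ ≤ ‖w‖`; `‖c_p w‖ ≤ ‖w‖` is reused from
  `Theorems/DeformationLadderLowEnergyRigiditySpinSqueezeKinematic.lean`, `DeformationLadder.ss_…`);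
* the LINK AVERAGE `A_b` (average of a vector over the value `u ∈ Q8` of link `b`): a self-adjoint
  idempotent contraction, whose complement `E_b = 1 - A_b` is the electric projection of link `b`;
  `A_b` commutes with fibred operators blind to link `b` and kills, between two averages, any fibred
  operator whose link-`b` weight has zero mean.

Elementary; no facts, no definitions beyond `Q`, `lavg`, `flipEquiv` (norm bookkeeping reused from
`Literature…WilsonHoppingAlgebra`: `NeubergerBound.eucNorm_sq_eq_sum(_slices)`). Refuter crux-attack 2026-08-17.
-/

-- `HubbardSuperconductivity.HubbardSuperconductivity` is the mandated Summit/Sub namespace (D-0017).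
set_option linter.dupNamespace false

noncomputable section

namespace Summit.HubbardSuperconductivity.HubbardSuperconductivity.Theorems

namespace SgAnchorFreeze

open Literature.MathematicalPhysics.QuantumLattice Literature.Hubbard Matrix Finset
open scoped Kronecker ComplexOrder

/-! ### Generic vector lemmas -/

section Generic

variable {n : Type*} [Fintype n]

/-- `‖v‖ = 0 ↔ v = 0`. [folklore] -/
theorem eucNorm_eq_zero_iff (v : n → ℂ) : eucNorm v = 0 ↔ v = 0 := by
  rw [eucNorm, norm_eq_zero, WithLp.toLp_eq_zero]

/-- A nonzero vector has positive norm. [folklore] -/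
theorem eucNorm_pos_of_ne_zero {v : n → ℂ} (hv : v ≠ 0) : 0 < eucNorm v :=
  lt_of_le_of_ne (eucNorm_nonneg v) (fun h => hv ((eucNorm_eq_zero_iff v).1 h.symm))

end Generic

/-! ### Fibred (Kronecker-with-diagonal) operators -/

section Fibre

variable {α γ : Type*} [Fintype α] [Fintype γ]

/-- Action of a fibred operator `A ⊗ diag d`: `((A ⊗ diag d) v)(s,k) = d(k) · (A v(·,k))(s)`. [folklore] -/
theorem kron_diagonal_mulVec_apply [DecidableEq γ] (A : Matrix α α ℂ) (d : γ → ℂ)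
    (v : α × γ → ℂ) (s : α) (k : γ) :
    ((A ⊗ₖ diagonal d) *ᵥ v) (s, k) = d k * (A *ᵥ fun s' => v (s', k)) s := by
  simp only [mulVec, dotProduct, Fintype.sum_prod_type, kroneckerMap_apply, diagonal_apply]
  rw [Finset.mul_sum]
  refine Finset.sum_congr rfl fun s' _ => ?_
  rw [Finset.sum_eq_single k]
  · simp only [if_true]; ring
  · intro k' _ hk'
    simp [Ne.symm hk']
  · intro h; exact absurd (Finset.mem_univ k) h

/-- Action of `1 ⊗ B`: it acts in the second factor, fibrewise in the first. [folklore] -/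
theorem one_kron_mulVec_apply [DecidableEq α] (B : Matrix γ γ ℂ) (v : α × γ → ℂ) (s : α) (k : γ) :
    (((1 : Matrix α α ℂ) ⊗ₖ B) *ᵥ v) (s, k) = (B *ᵥ fun k' => v (s, k')) k := by
  simp only [mulVec, dotProduct, Fintype.sum_prod_type, kroneckerMap_apply, one_apply]
  rw [Finset.sum_eq_single s]
  · simp
  · intro s' _ hs'
    simp [Ne.symm hs']
  · intro h; exact absurd (Finset.mem_univ s) h

/-- The `k`-fibre of `(A ⊗ diag d) v` is `d(k) • A v(·,k)`. [folklore] -/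
theorem fibre_kron_diagonal_mulVec [DecidableEq γ] (A : Matrix α α ℂ) (d : γ → ℂ)
    (v : α × γ → ℂ) (k : γ) :
    (fun s => ((A ⊗ₖ diagonal d) *ᵥ v) (s, k)) = d k • (A *ᵥ fun s' => v (s', k)) := by
  funext s
  rw [kron_diagonal_mulVec_apply]
  rfl

/-- `⟨v, (A ⊗ diag d) v⟩ = Σ_k d(k) ⟨v(·,k), A v(·,k)⟩`. [folklore] -/
theorem star_dotProduct_kron_diagonal_mulVec [DecidableEq γ] (A : Matrix α α ℂ) (d : γ → ℂ)
    (v : α × γ → ℂ) :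
    star v ⬝ᵥ ((A ⊗ₖ diagonal d) *ᵥ v) =
      ∑ k, d k * (star (fun s => v (s, k)) ⬝ᵥ (A *ᵥ fun s => v (s, k))) := by
  simp only [dotProduct, Fintype.sum_prod_type_right, Pi.star_apply, kron_diagonal_mulVec_apply,
    Finset.mul_sum]
  refine Finset.sum_congr rfl fun k _ => Finset.sum_congr rfl fun s _ => ?_
  ring

/-- A fibred operator `A ⊗ diag d` with `‖A‖ ≤ C` fibrewise and `|d| ≤ 1` has norm `≤ C`. [folklore] -/
theorem eucNorm_kron_diagonal_mulVec_le [DecidableEq γ] {C : ℝ} (hC : 0 ≤ C) (A : Matrix α α ℂ)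
    (d : γ → ℂ) (hA : ∀ w : α → ℂ, eucNorm (A *ᵥ w) ≤ C * eucNorm w) (hd : ∀ k, ‖d k‖ ≤ 1)
    (v : α × γ → ℂ) :
    eucNorm ((A ⊗ₖ diagonal d) *ᵥ v) ≤ C * eucNorm v := by
  apply le_of_pow_le_pow_left₀ two_ne_zero (mul_nonneg hC (eucNorm_nonneg v))
  rw [NeubergerBound.eucNorm_sq_eq_sum_slices, mul_pow, NeubergerBound.eucNorm_sq_eq_sum_slices, Finset.mul_sum]
  refine Finset.sum_le_sum fun k _ => ?_
  rw [fibre_kron_diagonal_mulVec, eucNorm_smul]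
  have h1 := hA (fun s' => v (s', k))
  have h2 := hd k
  have h3 := eucNorm_nonneg (A *ᵥ fun s' => v (s', k))
  have h4 := eucNorm_nonneg (fun s' => v (s', k))
  have h5 : ‖d k‖ * eucNorm (A *ᵥ fun s' => v (s', k)) ≤ C * eucNorm (fun s' => v (s', k)) := by
    calc ‖d k‖ * eucNorm (A *ᵥ fun s' => v (s', k))
        ≤ 1 * (C * eucNorm (fun s' => v (s', k))) :=
          mul_le_mul h2 h1 h3 zero_le_one
      _ = C * eucNorm (fun s' => v (s', k)) := one_mul _
  have h6 : 0 ≤ ‖d k‖ * eucNorm (A *ᵥ fun s' => v (s', k)) := mul_nonneg (norm_nonneg _) h3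
  calc (‖d k‖ * eucNorm (A *ᵥ fun s' => v (s', k))) ^ 2
      ≤ (C * eucNorm (fun s' => v (s', k))) ^ 2 := pow_le_pow_left₀ h6 h5 2
    _ = C ^ 2 * eucNorm (fun s' => v (s', k)) ^ 2 := by ring

end Fibre

/-! ### Norm bounds for the Jordan–Wigner matrices -/

section Fock

variable {ι : Type*} [LinearOrder ι] [Fintype ι]

/-- `‖c†_p w‖ ≤ ‖w‖` (mixed CAR). [folklore] -/
theorem eucNorm_creation_mulVec_le (p : ι) (w : Fock ι) :
    eucNorm (creation p *ᵥ w) ≤ eucNorm w := by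
  apply le_of_pow_le_pow_left₀ two_ne_zero (eucNorm_nonneg w)
  have h : eucNorm (creation p *ᵥ w) ^ 2 =
      eucNorm w ^ 2 - eucNorm (annihilation p *ᵥ w) ^ 2 := by
    rw [eucNorm_sq (creation p *ᵥ w), ← star_dotProduct_annihilation_mulVec, mulVec_mulVec,
      annihilation_mul_creation, if_pos rfl, sub_mulVec, one_mulVec, dotProduct_sub, Complex.sub_re,
      ← eucNorm_sq, ← eucNorm_annihilation_mulVec_sq]
  rw [h]
  nlinarith [sq_nonneg (eucNorm (annihilation p *ᵥ w))]

/-- `‖c†_p c_q w‖ ≤ ‖w‖`. [folklore] -/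
theorem eucNorm_cre_ann_mulVec_le (p q : ι) (w : Fock ι) :
    eucNorm ((creation p * annihilation q) *ᵥ w) ≤ 1 * eucNorm w := by
  rw [← mulVec_mulVec, one_mul]
  exact (eucNorm_creation_mulVec_le p _).trans (DeformationLadder.ss_eucNorm_annihilation_mulVec_le q w)

/-- `‖c_p c_q w‖ ≤ ‖w‖`. [folklore] -/
theorem eucNorm_ann_ann_mulVec_le (p q : ι) (w : Fock ι) :
    eucNorm ((annihilation p * annihilation q) *ᵥ w) ≤ 1 * eucNorm w := by
  rw [← mulVec_mulVec, one_mul]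
  exact (DeformationLadder.ss_eucNorm_annihilation_mulVec_le p _).trans
    (DeformationLadder.ss_eucNorm_annihilation_mulVec_le q w)

end Fock

/-! ### The link alphabet and link averaging -/

/-- The link alphabet `Q8` coded as `Fin 2 × ZMod 4`. [folklore] -/
abbrev Q : Type := Fin 2 × ZMod 4

/-- `|Q8| = 8`. [folklore] -/
theorem card_Q : Fintype.card Q = 8 := by
  simp [Q]

section LinkAvg

variable {α β : Type*} [DecidableEq β]

/-- Averaging a vector over the value of link `b`. [folklore] -/
def lavg (b : β) (v : α × (β → Q) → ℂ) : α × (β → Q) → ℂ :=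
  fun ik => (8 : ℂ)⁻¹ * ∑ u : Q, v (ik.1, Function.update ik.2 b u)

/-- Pointwise formula for the link average. [folklore] -/
theorem lavg_apply (b : β) (v : α × (β → Q) → ℂ) (s : α) (k : β → Q) :
    lavg b v (s, k) = (8 : ℂ)⁻¹ * ∑ u : Q, v (s, Function.update k b u) := rfl

/-- The link average is additive. [folklore] -/
theorem lavg_add (b : β) (v w : α × (β → Q) → ℂ) : lavg b (v + w) = lavg b v + lavg b w := by
  funext ik
  simp only [lavg, Pi.add_apply, Finset.sum_add_distrib, mul_add]

/-- The link average is homogeneous. [folklore] -/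
theorem lavg_smul (b : β) (c : ℂ) (v : α × (β → Q) → ℂ) : lavg b (c • v) = c • lavg b v := by
  funext ik
  simp only [lavg, Pi.smul_apply, smul_eq_mul, ← Finset.mul_sum]
  ring

/-- The link average of `0` is `0`. [folklore] -/
theorem lavg_zero (b : β) : lavg b (0 : α × (β → Q) → ℂ) = 0 := by
  funext ik
  simp [lavg]

/-- The link average of a finite sum. [folklore] -/
theorem lavg_sum {ι' : Type*} (b : β) (s : Finset ι') (f : ι' → α × (β → Q) → ℂ) :
    lavg b (∑ i ∈ s, f i) = ∑ i ∈ s, lavg b (f i) := by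
  classical
  induction s using Finset.induction_on with
  | empty => simp [lavg_zero]
  | insert a s ha ih => rw [Finset.sum_insert ha, Finset.sum_insert ha, lavg_add, ih]

/-- The average does not depend on the value of link `b`. [folklore] -/
theorem lavg_update (b : β) (v : α × (β → Q) → ℂ) (s : α) (k : β → Q) (u : Q) :
    lavg b v (s, Function.update k b u) = lavg b v (s, k) := by
  simp only [lavg_apply, Function.update_idem]

/-- The link average is idempotent. [folklore] -/
theorem lavg_lavg (b : β) (v : α × (β → Q) → ℂ) : lavg b (lavg b v) = lavg b v := by
  funext ⟨s, k⟩
  rw [lavg_apply]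
  simp only [lavg_update, Finset.sum_const, Finset.card_univ, card_Q, nsmul_eq_mul]
  push_cast
  ring

/-- A vector constant in the links is fixed by every link average. [folklore] -/
theorem lavg_of_const (b : β) (f : α → ℂ) :
    lavg b (fun ik : α × (β → Q) => f ik.1) = fun ik => f ik.1 := by
  funext ⟨s, k⟩
  rw [lavg_apply]
  simp only [Finset.sum_const, Finset.card_univ, card_Q, nsmul_eq_mul]
  push_cast
  ring

/-- Sums over `α × (β → Q)` split (only this product, not the alphabet `Q`). [folklore] -/
theorem sum_prod_αK [Fintype α] [Fintype β] (f : α × (β → Q) → ℂ) :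
    ∑ ik, f ik = ∑ s, ∑ k, f (s, k) := Fintype.sum_prod_type f

/-- Sums over `(β → Q) × Q` split. [folklore] -/
theorem sum_prod_KQ [Fintype β] (f : (β → Q) × Q → ℂ) :
    ∑ p, f p = ∑ k, ∑ u, f (k, u) := Fintype.sum_prod_type f

/-- The involution `(k, u) ↦ (k[b ↦ u], k b)` used for self-adjointness of the average. [folklore] -/
def flipEquiv (b : β) : (β → Q) × Q ≃ (β → Q) × Q where
  toFun := fun ku => (Function.update ku.1 b ku.2, ku.1 b)
  invFun := fun ku => (Function.update ku.1 b ku.2, ku.1 b)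
  left_inv := by
    rintro ⟨k, u⟩
    simp
  right_inv := by
    rintro ⟨k, u⟩
    simp

variable [Fintype α] [Fintype β]

/-- The link average is self-adjoint. [folklore] -/
theorem star_dotProduct_lavg (b : β) (w v : α × (β → Q) → ℂ) :
    star w ⬝ᵥ lavg b v = star (lavg b w) ⬝ᵥ v := by
  have h8 : star ((8 : ℂ)⁻¹) = (8 : ℂ)⁻¹ := by simp
  simp only [dotProduct, Pi.star_apply]
  rw [sum_prod_αK, sum_prod_αK]
  refine Finset.sum_congr rfl fun s _ => ?_
  simp only [lavg_apply, star_mul', star_sum, h8, Finset.mul_sum, Finset.sum_mul]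
  rw [← sum_prod_KQ (fun p => star (w (s, p.1)) * ((8 : ℂ)⁻¹ * v (s, Function.update p.1 b p.2))),
    ← sum_prod_KQ (fun p => (8 : ℂ)⁻¹ * star (w (s, Function.update p.1 b p.2)) * v (s, p.1))]
  refine Fintype.sum_equiv (flipEquiv b) _ _ fun p => ?_
  simp only [flipEquiv, Equiv.coe_fn_mk, Function.update_idem, Function.update_eq_self]
  ring

/-- Orthogonality form of self-adjointness: `⟨v, A v⟩ = ‖A v‖²`. [folklore] -/
theorem star_dotProduct_lavg_self (b : β) (v : α × (β → Q) → ℂ) :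
    star v ⬝ᵥ lavg b v = ((eucNorm (lavg b v) ^ 2 : ℝ) : ℂ) := by
  conv_lhs => rw [← lavg_lavg b v]
  rw [star_dotProduct_lavg, star_dotProduct_self_eq_eucNorm_sq]

/-- `‖A_b v‖ ≤ ‖v‖`. [folklore] -/
theorem eucNorm_lavg_le (b : β) (v : α × (β → Q) → ℂ) : eucNorm (lavg b v) ≤ eucNorm v := by
  by_cases h : eucNorm (lavg b v) = 0
  · rw [h]; exact eucNorm_nonneg v
  have hpos : 0 < eucNorm (lavg b v) := lt_of_le_of_ne (eucNorm_nonneg _) (Ne.symm h)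
  have h1 : ‖star v ⬝ᵥ lavg b v‖ ≤ eucNorm v * eucNorm (lavg b v) := norm_star_dotProduct_le _ _
  rw [star_dotProduct_lavg_self, Complex.norm_real, Real.norm_eq_abs, abs_of_nonneg (sq_nonneg _),
    sq] at h1
  exact le_of_mul_le_mul_right h1 hpos

/-- `Re ⟨v, v - A v⟩ = ‖v - A v‖²` (the complement of the average is an orthogonal projection). [folklore] -/
theorem re_star_dotProduct_sub_lavg (b : β) (v : α × (β → Q) → ℂ) :
    (star v ⬝ᵥ (v - lavg b v)).re = eucNorm (v - lavg b v) ^ 2 := by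
  rw [eucNorm_sq, star_sub, sub_dotProduct, dotProduct_sub, dotProduct_sub,
    ← star_dotProduct_lavg b v v, ← star_dotProduct_lavg b v (lavg b v), lavg_lavg]
  congr 1
  ring

/-- Self-adjointness of the complementary projection `1 - A`. [folklore] -/
theorem star_dotProduct_sub_lavg (b : β) (x y : α × (β → Q) → ℂ) :
    star (x - lavg b x) ⬝ᵥ y = star x ⬝ᵥ (y - lavg b y) := by
  rw [star_sub, sub_dotProduct, dotProduct_sub, star_dotProduct_lavg]

/-- Link averaging commutes with a fibred operator whose link weight ignores link `b`. [folklore] -/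
theorem lavg_kron_diagonal_mulVec_of_indep [DecidableEq α] (b : β) (A : Matrix α α ℂ)
    (d : (β → Q) → ℂ) (hd : ∀ k u, d (Function.update k b u) = d k) (v : α × (β → Q) → ℂ) :
    lavg b ((A ⊗ₖ diagonal d) *ᵥ v) = (A ⊗ₖ diagonal d) *ᵥ lavg b v := by
  funext ⟨s, k⟩
  rw [lavg_apply, kron_diagonal_mulVec_apply]
  simp only [kron_diagonal_mulVec_apply, hd]
  rw [← Finset.mul_sum, ← mul_assoc, mul_comm ((8 : ℂ)⁻¹), mul_assoc]
  congr 1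
  simp only [mulVec, dotProduct, Finset.mul_sum, lavg_apply]
  rw [Finset.sum_comm]
  refine Finset.sum_congr rfl fun s' _ => ?_
  ring

/-- A fibred operator whose link weight on `b` has zero mean is killed between two averages. [folklore] -/
theorem lavg_kron_diagonal_mulVec_lavg_eq_zero [DecidableEq α] (b : β) (A : Matrix α α ℂ)
    (d : (β → Q) → ℂ) (hd : ∀ k, ∑ u : Q, d (Function.update k b u) = 0)
    (v : α × (β → Q) → ℂ) :
    lavg b ((A ⊗ₖ diagonal d) *ᵥ lavg b v) = 0 := by
  funext ⟨s, k⟩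
  rw [lavg_apply]
  simp only [kron_diagonal_mulVec_apply]
  have hconst : ∀ u : Q, (fun s' => lavg b v (s', Function.update k b u)) = fun s' => lavg b v (s', k) := by
    intro u; funext s'; exact lavg_update b v s' k u
  simp only [hconst, ← Finset.sum_mul, hd]
  simp

end LinkAvg

end SgAnchorFreeze

end Summit.HubbardSuperconductivity.HubbardSuperconductivity.Theorems
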